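import Literature.Barriers.Parity.SiegelZeroDichotomyNoSiegelZeros
import Literature.Barriers.Parity.SiegelZeroPrimePairsTheorem2
import Literature.NumberTheory.Sieve.MontgomeryVaughan1975Tools
import Literature.NumberTheory.LFunctions.SiegelExceptionalZeroBound
import HarnessLib
import Summits.Parity.GeneralizedHardyLittlewood.Theorems.UnboundedSiegelZeros

/-!
# Barrier catalogue `Parity`, entry `SiegelZeroPrimePairs` — CONFIRMED and SHARPENED (barrier audit 2026-08-16, D-0021)

Topic `Literature/Barriers/Parity`. The catalogued record
`Literature.Barriers.Parity.SiegelZeroPrimePairBarrier` (Goldston–Suriajaya 2021, Theorem 2: the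
Hardy–Littlewood Prime-Pair Upper Bound Conjecture `ψ₂(x, k) ≤ (2 − δ)𝔖(k)(x − k) + o(𝔖(k)x)`,
uniformly for even `2 ≤ k ≤ x`, forces `β₁ < 1 − C(δ)/log² q` for real zeros of real `L(s, χ)`
mod `q`) is TRUE and PROVED in the tree (`SiegelZeroPrimePairBarrier_holds`, file
`SiegelZeroPrimePairsHolds.lean`), as is its Goldbach twin `GoldstonSuriajaya2021_goldbach_holds`.
Nothing in the entry is false, and no published work evades it. What the audit corrects is SLACK
in the catalogued block — in the direction that makes the barrier bite harder, so no technique is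
released by it — and it pins down the exact family of instances that carries the obstruction,
hence (for planners) its complement:

1. **The conclusion is the no-Siegel-zero statement itself, not `log² q`-repulsion.** Within a
   month of the source, Friedlander–Iwaniec replaced Goldston–Suriajaya's window `C(δ)/log² q`
   by `c(δ)/log q` on the Goldbach side ("In those works the results led to an interval of width
   `c/(log q)²` rather than `c/log q` … our main innovation is the use of a theorem of Bombieri …
   zero repulsion"; Theorem 1: under the Weak Hardy–Littlewood–Goldbach conjecture "there are no
   zeros of any Dirichlet `L`-function in the region (1.1) with a positive constant `c` which is
   now allowed to depend on `δ`") [cite: FriedlanderIwaniec2021, §1 and Theorem 1], published as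
   Friedlander–Goldston–Iwaniec–Suriajaya 2022 and restated in
   [cite: FriedlanderIwaniec2022, §4 (Theorem)] ("Those works had narrowed the escape window for the
   exceptional zeros but did not close it tightly"); Matomäki–Merikoski's Corollary 1.2 needs the
   two-sided Goldbach bound at ONE `h ≡ 0 (mod q)` only [cite: MatomakiMerikoski2023, Corollary 1.2].
   For PRIME PAIRS — the subject of this entry (sub-problem `BatemanHorn`) — the same upgrade is
   not printed as a corollary, but it is three lines from Matomäki–Merikoski's Theorem 1.3 at the
   shift `h = 2q` ("one would expect that `∑_{n ≤ X} Λ(n)Λ(n + q) ≈ 2𝔖_q X`. The following general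
   theorem confirms this intuition" [cite: MatomakiMerikoski2023, §1 (before Theorem 1.3)]), and it
   is PROVED here modulo that vendored theorem: `SiegelZeroPrimePairBarrierNarrow_of_pairCorrelation`.
   The conclusion is literally the tree's open statement `Literature.NumberTheory.LFunctions.NoSiegelZeros`
   (rh.S34), reached through `¬UnboundedSiegelZeros` (bounded quality at large conductors, entry
   `SiegelZeroDichotomy`) and `noSiegelZeros_of_not_unboundedSiegelZeros`.
2. **The hypothesis is a thin family.** Goldston–Suriajaya average `ψ₂(x, qj)` over ALL multiples
   `qj` of the modulus with the weight `e^{−(2n−qj)/N}` at the height `log N = (log q/c'')²` forced by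
   the error term `O(x e^{−c₁√log x})` of their prime number theorem for progressions
   [cite: GoldstonSuriajaya2021, §5 (proof of Theorem 3) and §7]; that height is exactly what limits
   them to `log² q`. Theorem 1.3 needs ONE shift per modulus at ONE polynomial height:
   `HLPrimePairUpperBoundThin V δ` = "`ψ₂(q^V + 2q, 2q) ≤ (2 − δ)𝔖(2q)q^V` for all large `q`"
   (`V ≥ 10` a fixed natural number), an instance of `HLPrimePairUpperBoundConj δ'` for every
   `δ' > δ` (`hlPrimePairUpperBoundThin_of_conj`). So the obstruction is carried by the pairs
   `(x, k)` with `k` a multiple of a large exceptional conductor `q` and `x − k = q^V`, `V ≥ 10`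
   (any `k = 2qj = O(x)` would do as well).
3. **The sharp record implies the catalogued one** (`siegelZeroPrimePairBarrier_of_narrow`, via
   `siegelZeroPrimePairBarrier_of_noSiegelZeros`: under rh.S34 the window `(1 − c/log q, 1)` of the
   catalogued conclusion contains no real zero of any real `L(s, χ)` mod `q ≥ 3`, principal and
   imprimitive characters included — Mathlib's `LFunction_changeLevel` and `ζ(β) < 0` on `(0, 1)`).

Where the obstruction is SILENT (the complement of the thin family; information for planners, not
new obstructions — on these only Selberg's parity barrier, entries `PrimePairParity` /
`SelbergParity`, stands):

* fixed shifts and fixed Bateman–Horn systems (already in the catalogued `scope_caveats`; an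
  exceptional zero even PROVES the pair asymptotic on `[q^{10}, q^{η^{1−ε}}]`
  [cite: MatomakiMerikoski2023, Corollary 1.1]);
* conductors in the Siegel–Walfisz range: for `q ≤ (log x)^A` an exceptional zero is invisible at
  height `x` — `errorFactor_ge_one_of_le_log_pow` (PROVED from the tree's Siegel theorem, MV
  Cor. 11.15): the error factor `V log⁶η/η` of Theorem 1.3 is `≥ 1` there, and Goldston–Suriajaya's
  height needs `q = e^{c''√log N}`; so uniformity over shifts `k ≤ (log x)^A` (every divisor `q ∣ k` is
  then `≤ (log x)^A`) is not touched by this entry;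
* shift families avoiding the multiples of large conductors, e.g. `B`-smooth shifts (`B ≥ 3`): an
  exceptional `q = 2^r q'` (`q'` odd squarefree, "note that `q'` is necessarily square-free") either
  divides `8·∏_{p ≤ B} p` (finitely many) or has a prime factor `P > B`, `P ∤ k`, and then the
  correction factor of Theorem 1.3, `1 + θ∏_{p ∣ q', p ∤ k} (p − 2)^{−1}` with `θ ∈ {0, 1, −1}`, lies
  within `1 ± 1/(P − 2) ⊂ 1 ± 1/(B − 1)`; so for `δ < 1 − 1/(B − 1)` the illusory world satisfies the
  `(2 − δ)` bound (indeed the asymptotic up to that factor) along such families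
  [cite: MatomakiMerikoski2023, Theorem 1.3 and the remark after it];
* LOWER bounds `ψ₂ ≥ δ𝔖(k)(x − k)`, `δ < 2/3`: in the illusory world they fail only at
  `χ`-reversing shifts (correction factor `0`; otherwise it is `≥ 1 − 1/3`), which exist only when
  `3 ∣ q` or `4 ∣ q` ("Note that the main term vanishes for some even `h`, for instance when `3 ∣ q`
  and `h = 2q/3`") [cite: MatomakiMerikoski2023, remark after Theorem 1.3] — this entry records the
  UPPER-bound obstruction only;
* qualitative existence statements: "one should not lose hope of proving the original Goldbach
  conjecture before killing off the exceptional characters because, to this end, when one is not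
  worried about quantitative bounds, one can skip counting many inconvenient representations"
  [cite: FriedlanderIwaniec2022, §5 (Remarks)].

Robustness (the barrier is NOT evaded by thinning the hypothesis in the obvious ways): an
exceptional set of shifts/numbers does not help — Bhowmik–Halupczok allow the weak Goldbach bounds
to fail on an exceptional set (as reported in [cite: GoldstonSuriajaya2021, §1]), and
Bhowmik–Grimmelt's Theorem 8.2 (2026) excludes a real zero `β̃ > 1 − c/log X` of a primitive real
character mod `r̃` from the two-sided bound (8.4) for all but `X^{3/5}` even `N ∈ [X/2, X]` with
`r̃ ∣ N`, `X = r̃^A`, `A > 5/2` [cite: BhowmikGrimmelt2026, Theorem 8.2]; and Friedlander–Iwaniec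
extend the Goldbach mechanism to general binary sums `F(n) = ∑_{ℓ+m=n} a(ℓ)b(m)` with almost-prime
weights, "for the purpose of showing clearly that the questions are linked to the parity barrier of
sieve theory" [cite: FriedlanderIwaniec2022, §1 and §5 (Conclusion)].

## What the sources print (verified on the page; arXiv page numbers)

* D. A. Goldston, A. I. Suriajaya, arXiv:2104.09407v1 [cite: GoldstonSuriajaya2021, §1 ((7), (8), (10), Theorems 1, 2), §5 (Theorem 3), §7].
  p. 3: "The Hardy-Littlewood conjecture we need here is that, for even `2 ≤ k ≤ x`,
  `ψ₂(x,k) = 𝔖(k)(x−k) + o(𝔖(k)x)`. Note that this is true in the range `x − o(x) ≤ k ≤ x` by a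
  standard sieve result"; "Hardy-Littlewood Prime-Pair Upper Bound Conjecture. Given a fixed
  constant `0 < δ < 1`, then for even `2 ≤ k ≤ x` and sufficiently large `x`, we have
  `ψ₂(x,k) ≤ (2−δ)𝔖(k)(x−k) + o(𝔖(k)x)`"; "Theorem 2. Theorem 1 holds if we replace the Weak
  Hardy-Littlewood Goldbach Conjecture with the Hardy-Littlewood Prime-Pair Upper Bound
  Conjecture." p. 7 (Theorem 3 and its proof): "`β₁ < 1 − ½(c')² log(1/(1−δ))/log² q`", "Defining
  `N` by `log N := ((1/c'') log q)²` … `q = e^{c''√log N}`". p. 9 (§7):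
  "`𝒯(q) = Ψ₂(r,0) + 2∑_{k: q ∣ k} Ψ₂(r,k) = Ψ₂(r,0) + 2∑_j Ψ₂(r,qj)`",
  "`𝒯(q) ≤ (2−δ)(N²/φ(q))(1+o(1)) + O(N log² N)`",
  "`𝒯(q) = N²/φ(q) + Γ(β₁)²N^{2β₁}/φ(q) + O(N² e^{−c₁√log N})`".
* J. Friedlander, H. Iwaniec, *Note on a note of Goldston and Suriajaya*, arXiv:2105.09038
  [cite: FriedlanderIwaniec2021, Abstract, §1 (Theorem 1), §5, §7 (Conclusion)]. Abstract: "the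
  assumption of a weak form of the Hardy-Littlewood conjecture on the Goldbach problem suffices to
  disprove the possible existence of exceptional zeros of Dirichlet `L`-functions. This strengthens
  a result of the authors named in the title." §5: "if `N ≥ q^{b+1}`". §7: "Conclusion: The
  assumption (7.1) with some positive `δ` implies that there is a real zero-free interval
  `s ≥ 1 − c(δ)/log q` … In the case that `χ₁(−1) = 1` only the upper bound in (7.1) is required
  and in the other case, that `χ₁(−1) = −1`, only the lower bound is required."
* J. B. Friedlander, H. Iwaniec, *Exceptional zeros, sieve parity, Goldbach*, Essent. Number
  Theory 1 (2022) 13–39 [cite: FriedlanderIwaniec2022, §1, §3, §4 (Theorem), §5 (Conclusion, Remarks)].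
  §4: "In [Friedlander and Iwaniec 2021; Friedlander et al. 2022] the following result is proved.
  Theorem. Assume that the Weak Hardy–Littlewood–Goldbach conjecture holds for all sufficiently
  large even `n`. Then, there are no zeros of any Dirichlet `L`-function in the region (1-1) with a
  positive constant `c` which is now allowed to depend on `δ`." §3: "the replacement of `2` by
  `2 − η` with a fixed positive `η` in a range `x > q^{A(η)}`, would lead to the banishment of
  exceptional zeros" (Brun–Titchmarsh; entry `BrunTitchmarshSiegelZero`), and Siebert / Granville:
  "a fixed improvement of the value of either `F(s)`, `f(s)` for any value of `s`, again in the case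
  of arithmetic progressions and with `x` larger than a sufficiently large power of `q`, implies
  that exceptional zeros do not exist."
* J. B. Friedlander, D. A. Goldston, H. Iwaniec, A. I. Suriajaya, *Exceptional zeros and the
  Goldbach problem*, J. Number Theory 233 (2022) 78–86 [cite: FriedlanderEtAl2022, main theorem (as reported in FriedlanderIwaniec2022 §4 and MatomakiMerikoski2023 §1)] —
  not held (acquisition request acq-06038); quoted only through those two reports ("who got a
  similar conclusion assuming that (1.6) holds for several `h ≡ 0 (mod q)`").
* K. Matomäki, J. Merikoski, IMRN 2023 (arXiv:2112.11412) [cite: MatomakiMerikoski2023, §1 (Corollaries 1.1, 1.2, Theorem 1.3 and the remarks around it)].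
  p. 3: Corollary 1.2 (Goldbach, one even `h ∈ [q^{10}, q^{η^{99/100}}]`, `q ∣ h`): "Then the
  Dirichlet `L`-function `L(s, χ)` does not have an exceptional zero `β₀` with
  `β₀ ≥ 1 − 1/(η log q)`. This improves on a recent result of Friedlander, Goldston, Iwaniec and
  Suriajaya … In fact, our result is even stronger and we only need the lower bound in (1.6) if
  `χ(−1) = −1` and similarly only the upper bound in (1.6) if `χ(−1) = 1`." "the residue classes
  `a (mod q)` with `χ(a) = −1` contain about twice as many primes as one would expect … Consequently
  one would expect that `∑_{n ≤ X} Λ(n)Λ(n+q) ≈ 2𝔖_q X`. The following general theorem confirms this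
  intuition." p. 4 (after Theorem 1.3): "Note that the main term vanishes for some even `h`, for
  instance when `3 ∣ q` and `h = 2q/3` (note that `q'` is necessarily square-free … and so in this
  case `3 ∤ h`)"; "Corollaries 1.1(i) and 1.2 immediately follow from Theorems 1.3 and 1.4 since by
  Siegel's theorem … `η ≪_ε q^ε`."
* G. Bhowmik, L. Grimmelt, *The exceptional set of the Goldbach problem*, arXiv:2607.27282v2
  (13 Aug 2026) [cite: BhowmikGrimmelt2026, §8 (Theorem 8.2)]. "Theorem 8.2. Fix `A > 5/2` and
  `δ ∈ (0,1)`. There are `c = c(δ) > 0` and `r₀ = r₀(A, δ)` such that the following holds for every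
  `r̃ ≥ r₀`. Let `X = r̃^A` and assume that (8.4) `δ𝔖(N)N ≤ r₂(N) ≤ (2−δ)𝔖(N)N` holds for all but at
  most `X^{3/5}` even `N ∈ [X/2, X]` with `r̃ ∣ N`, then no `L(s, χ̃)` with `χ̃` a primitive real
  character modulo `r̃` has a real zero `β̃ > 1 − c/log X`." "This approach does fall short of the
  more recent result of Matomäki–Merikoski [16, Cor. 1.2], who need only a single multiple `N` of
  the conductor … since their hypothesis lives at the scale `N ≥ r̃^{10}`, while ours operates at
  `N ∼ r̃^A` for any fixed `A > 5/2`, their statement does not imply ours."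
* H. L. Montgomery, R. C. Vaughan, *Multiplicative Number Theory I*, Cor. 11.15 (Siegel's theorem
  for real zeros; tree: `Literature.NumberTheory.LFunctions.Siegel.exists_one_sub_realZero_ge`, PROVED)
  [cite: MontgomeryVaughan2007, Corollary 11.15].

## Contents

* `HLPrimePairUpperBoundThin V δ` — the thin family (one shift `2q` per modulus, height `q^V`);
  `primePairLambdaCount_thin_eq` (it is Matomäki–Merikoski's sum), `hlPrimePairUpperBoundThin_of_conj`
  (`HLPrimePairUpperBoundConj δ → HLPrimePairUpperBoundThin V δ'`, `δ' < δ`, `V ≥ 2`);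
* `SiegelZeroPrimePairBarrierNarrow.correction_two_mul` — the correction factor of Theorem 1.3 is
  `+1` at `h = 2q` (main term doubles);
* `not_unboundedSiegelZeros_of_hlPrimePairUpperBoundThin` — the thin family bounds the quality of
  Siegel zeros at large conductors, modulo `MatomakiMerikoski2023_pairCorrelation`;
* `SiegelZeroPrimePairBarrierNarrow` — the sharp record (docstring = BARRIER block), PROVED modulo
  Theorem 1.3 (`SiegelZeroPrimePairBarrierNarrow_of_pairCorrelation`); corollaries
  `noSiegelZeros_of_hlPrimePairUpperBoundConj`, `siegelZeroQuality_lt_of_hlPrimePairUpperBoundThin`;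
* `SiegelZeroPrimePairBarrierNarrow.windowZeroFree_of_noSiegelZeros`,
  `siegelZeroPrimePairBarrier_of_noSiegelZeros`, `siegelZeroPrimePairBarrier_of_narrow` — the
  sharp record implies the catalogued one;
* `errorFactor_ge_one_of_le_log_pow` — silence in the Siegel–Walfisz range (proved from Siegel's
  theorem).

No statement of `SiegelZeroPrimePairs.lean` is changed; this file only adds. The one new closed
`Prop` is the record `SiegelZeroPrimePairBarrierNarrow` (D-0026), derived in-tree from the already
registered fact `MatomakiMerikoski2023_pairCorrelation`.
-/

noncomputable section

open Filter Finset Real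
open scoped ArithmeticFunction.vonMangoldt Topology

namespace Literature.Barriers.Parity

open Literature.NumberTheory.Sieve Literature.NumberTheory.LFunctions

/-! ### 1. The thin family of instances of (10) that carries the obstruction -/

/-- **The thin family.** The instances `(x, k) = (q^V + 2q, 2q)`, `q ≥ q₀`, of
Goldston–Suriajaya's hypothesis (10) (`HLPrimePairUpperBoundConj`), with the `o(𝔖(k)x)`
absorbed into `δ`: `ψ₂(q^V + 2q, 2q) ≤ (2 − δ)𝔖(2q)q^V` for all large `q` — one shift per
modulus, at the single height `x − k = q^V` of Matomäki–Merikoski's Theorem 1.3 (there `X = q^V`,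
`V ≥ 10`). Implied by `HLPrimePairUpperBoundConj δ'` for every `δ' > δ` and `V ≥ 2`
(`hlPrimePairUpperBoundThin_of_conj`).
[cite: GoldstonSuriajaya2021, §1 (10)] [cite: MatomakiMerikoski2023, Theorem 1.3] -/
def HLPrimePairUpperBoundThin (V : ℕ) (δ : ℝ) : Prop :=
  ∃ q₀ : ℕ, ∀ q : ℕ, q₀ ≤ q →
    primePairLambdaCount ((q : ℝ) ^ V + 2 * q) (2 * q) ≤
      (2 - δ) * goldbachSingularSeries (2 * q) * (q : ℝ) ^ V

/-- `ψ₂(q^V + 2q, 2q) = ∑_{1 ≤ n ≤ q^V} Λ(n)Λ(n + 2q)` (shift `n ↦ n + 2q` in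
Goldston–Suriajaya (7); the right side is the sum of Matomäki–Merikoski's Theorem 1.3 at
`X = q^V`, `h = 2q`). [cite: GoldstonSuriajaya2021, (7)] -/
theorem primePairLambdaCount_thin_eq (q V : ℕ) :
    primePairLambdaCount ((q : ℝ) ^ V + 2 * q) (2 * q) =
      ∑ n ∈ Icc 1 (q ^ V), Λ n * Λ (n + 2 * q) := by
  have hcast : (q : ℝ) ^ V + 2 * q = ((q ^ V + 2 * q : ℕ) : ℝ) := by norm_cast
  rw [primePairLambdaCount, hcast, Nat.floor_natCast]
  have hmap : Ioc (2 * q) (q ^ V + 2 * q) = (Ioc 0 (q ^ V)).map (addRightEmbedding (2 * q)) := by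
    rw [map_add_right_Ioc, zero_add]
  have hIoc : Icc 1 (q ^ V) = Ioc 0 (q ^ V) := by
    ext n; simp only [mem_Icc, mem_Ioc]; omega
  rw [hmap, sum_map, hIoc]
  refine sum_congr rfl fun n _ => ?_
  simp only [addRightEmbedding_apply, Nat.add_sub_cancel]
  ring

/-- **Hypothesis (10) contains the thin family**: `HLPrimePairUpperBoundConj δ` (all even
`2 ≤ k ≤ x`, `x` large, `ψ₂(x, k) ≤ (2 − δ)𝔖(k)(x − k) + η𝔖(k)x` for every `η > 0`) gives
`HLPrimePairUpperBoundThin V δ'` for every `δ' < δ`, `V ≥ 2`: take `η = (δ − δ')/2`,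
`x = q^V + 2q`, `k = 2q`, and use `x ≤ 2(x − k)`. [cite: GoldstonSuriajaya2021, §1 (10)] -/
theorem hlPrimePairUpperBoundThin_of_conj {V : ℕ} (hV : 2 ≤ V) {δ δ' : ℝ} (hlt : δ' < δ)
    (h : HLPrimePairUpperBoundConj δ) : HLPrimePairUpperBoundThin V δ' := by
  obtain ⟨x₀, hx₀⟩ := h ((δ - δ') / 2) (by linarith)
  refine ⟨max ⌈x₀⌉₊ 2, fun q hq => ?_⟩
  have hq2 : (2 : ℝ) ≤ q := by exact_mod_cast le_of_max_le_right hq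
  have hqx : (⌈x₀⌉₊ : ℝ) ≤ q := by exact_mod_cast le_of_max_le_left hq
  set X : ℝ := (q : ℝ) ^ V with hX
  have hXq : 2 * (q : ℝ) ≤ X := by
    have h1 : (q : ℝ) ^ 2 ≤ (q : ℝ) ^ V := pow_le_pow_right₀ (by linarith) hV
    nlinarith
  have hx : x₀ ≤ X + 2 * q := by linarith [Nat.le_ceil x₀]
  have hk : ((2 * q : ℕ) : ℝ) ≤ X + 2 * q := by push_cast; linarith
  have hb := hx₀ (X + 2 * q) hx (2 * q) (even_two_mul q) (by omega) hk
  have hcast : ((2 * q : ℕ) : ℝ) = 2 * (q : ℝ) := by push_cast; ring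
  rw [hcast, show X + 2 * (q : ℝ) - 2 * q = X by ring] at hb
  set 𝔖 : ℝ := goldbachSingularSeries (2 * q) with h𝔖
  have h𝔖0 : 0 ≤ 𝔖 := SingularSeriesMean.goldbachSingularSeries_nonneg _
  have h1 : (δ - δ') / 2 * (𝔖 * (X + 2 * q)) ≤ (δ - δ') / 2 * (𝔖 * (2 * X)) := by
    apply mul_le_mul_of_nonneg_left _ (by linarith)
    exact mul_le_mul_of_nonneg_left (by linarith) h𝔖0
  have h2 : (2 - δ) * 𝔖 * X + (δ - δ') / 2 * (𝔖 * (2 * X)) = (2 - δ') * 𝔖 * X := by ring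
  linarith [hb, h1, h2]

/-! ### 2. The correction factor of Theorem 1.3 at the shift `2q` -/

namespace SiegelZeroPrimePairBarrierNarrow

/-- At the shift `h = 2q` the correction factor of Matomäki–Merikoski's Theorem 1.3 equals `+1`,
so the main term DOUBLES ("one would expect that `∑_{n ≤ X} Λ(n)Λ(n+q) ≈ 2𝔖_q X`"):
`φ(2^r) ∣ 2q` (`r = v₂(q)`), `2q/φ(2^r)` is even, and every prime factor of `q' = q/2^r` divides
`2q` (empty product). [cite: MatomakiMerikoski2023, §1 (the paragraph before Theorem 1.3) and Theorem 1.3] -/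
theorem correction_two_mul {q : ℕ} (hq : 0 < q) :
    (1 + if Nat.totient (2 ^ padicValNat 2 q) ∣ 2 * q then
        (-1 : ℝ) ^ (2 * q / Nat.totient (2 ^ padicValNat 2 q)) *
          ∏ p ∈ (q / 2 ^ padicValNat 2 q).primeFactors.filter (fun p => ¬ p ∣ 2 * q),
            (-1 : ℝ) / ((p : ℝ) - 2)
      else 0) = 2 := by
  have _hq := hq
  set r := padicValNat 2 q with hr
  have ht : Nat.totient (2 ^ r) ∣ q := by
    rcases Nat.eq_zero_or_pos r with h0 | hpos
    · rw [h0, pow_zero, Nat.totient_one]; exact one_dvd q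
    · rw [Nat.totient_prime_pow Nat.prime_two hpos]
      calc 2 ^ (r - 1) * (2 - 1) = 2 ^ (r - 1) := by norm_num
        _ ∣ 2 ^ r := pow_dvd_pow 2 (Nat.sub_le r 1)
        _ ∣ q := pow_padicValNat_dvd
  have hdvd : Nat.totient (2 ^ r) ∣ 2 * q := ht.trans (dvd_mul_left q 2)
  have heven : Even (2 * q / Nat.totient (2 ^ r)) := by
    obtain ⟨m, hm⟩ := ht
    have htpos : 0 < Nat.totient (2 ^ r) := Nat.totient_pos.mpr (pow_pos two_pos r)
    refine ⟨m, ?_⟩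
    rw [show 2 * q = Nat.totient (2 ^ r) * (m + m) by rw [hm]; ring, Nat.mul_div_cancel_left _ htpos]
  have hempty : (q / 2 ^ r).primeFactors.filter (fun p => ¬ p ∣ 2 * q) = ∅ := by
    refine Finset.filter_eq_empty_iff.mpr fun p hp hndvd => hndvd ?_
    exact ((Nat.dvd_of_mem_primeFactors hp).trans
      (Nat.div_dvd_of_dvd pow_padicValNat_dvd)).trans (dvd_mul_left q 2)
  rw [if_pos hdvd, heven.neg_one_pow, hempty, Finset.prod_empty]
  norm_num

end SiegelZeroPrimePairBarrierNarrow

/-! ### 3. The thin family bounds the quality of Siegel zeros (modulo Theorem 1.3) -/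

/-- **The thin family refutes `UnboundedSiegelZeros`, modulo Matomäki–Merikoski's Theorem 1.3.**
At a real zero `1 − 1/(η log q)` of a primitive quadratic `χ` mod `q`, Theorem 1.3 (`C = 1`,
`ε = 1/10`, `A = 1`, `X = q^V`, `h = 2q`) gives
`|∑_{n ≤ q^V} Λ(n)Λ(n+2q) − 2𝔖(2q)q^V| ≤ K (2q/φ(2q)) q^V (e^{−√(V log η)} + e^{−√(V log q)} + V log⁶η/η)`
(`SiegelZeroPrimePairBarrierNarrow.correction_two_mul`), the thin bound caps the sum at
`(2 − δ)𝔖(2q)q^V`, and `𝔖(2q) ≥ C₂ · 2q/φ(2q)`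
(`Literature.NumberTheory.Sieve.MontgomeryVaughan1975.twinPrimeConst_mul_div_totient_le`); so
`δ C₂ ≤ 3Kε` once the three error terms are `≤ ε`, false for `ε = δC₂/(4K)` — which zeros of
unbounded quality at arbitrarily large conductors would supply.
[cite: MatomakiMerikoski2023, Theorem 1.3] -/
theorem not_unboundedSiegelZeros_of_hlPrimePairUpperBoundThin
    (hMM : MatomakiMerikoski2023_pairCorrelation) {V : ℕ} (hV : 10 ≤ V) {δ : ℝ} (hδ : 0 < δ)
    (hThin : HLPrimePairUpperBoundThin V δ) : ¬ Summit.Parity.GeneralizedHardyLittlewood.UnboundedSiegelZeros := by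
  intro hU
  have hC₂ : 0 < twinPrimeConst := twinPrimeConst_pos_holds
  have hVr : (10 : ℝ) ≤ (V : ℝ) := by exact_mod_cast hV
  have hV0 : (0 : ℝ) < (V : ℝ) := by linarith
  obtain ⟨q₁, hq₁⟩ := hThin
  obtain ⟨K, hK, hMM'⟩ := hMM 1 le_rfl (1 / 10) (by norm_num) 1 one_pos
  set ε : ℝ := δ * twinPrimeConst / (4 * K) with hε
  have hεpos : 0 < ε := by positivity
  -- thresholds: the three error terms of Matomäki–Merikoski are eventually `≤ ε`
  have hT1 : ∀ᶠ η : ℝ in atTop, Real.exp (-1 * Real.sqrt ((V : ℝ) * Real.log η)) ≤ ε := by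
    have h1 : Tendsto (fun η : ℝ => Real.exp (-1 * Real.sqrt ((V : ℝ) * Real.log η))) atTop
        (𝓝 0) := by
      refine Real.tendsto_exp_atBot.comp ?_
      have : Tendsto (fun η : ℝ => Real.sqrt ((V : ℝ) * Real.log η)) atTop atTop :=
        Real.tendsto_sqrt_atTop.comp (Real.tendsto_log_atTop.const_mul_atTop hV0)
      simpa using this.const_mul_atTop_of_neg (by norm_num : (-1 : ℝ) < 0)
    exact (h1.eventually (gt_mem_nhds hεpos)).mono fun _ h => h.le
  have hT2 : ∀ᶠ η : ℝ in atTop, (V : ℝ) * Real.log η ^ (6 : ℕ) / η ≤ ε := by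
    have h1 : Tendsto (fun η : ℝ => (V : ℝ) * Real.log η ^ (6 : ℕ) / η) atTop (𝓝 0) := by
      have := (Real.tendsto_pow_log_div_mul_add_atTop 1 0 6 one_ne_zero).const_mul (V : ℝ)
      rw [mul_zero] at this
      refine this.congr' (Eventually.of_forall fun η => ?_)
      simp only [one_mul, add_zero]
      ring
    exact (h1.eventually (gt_mem_nhds hεpos)).mono fun _ h => h.le
  have hT3 : ∀ᶠ X : ℝ in atTop, Real.exp (-1 * Real.log X ^ (3 / 5 - 1 / 10 : ℝ)) ≤ ε := by
    have h1 : Tendsto (fun X : ℝ => Real.exp (-1 * Real.log X ^ (3 / 5 - 1 / 10 : ℝ))) atTop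
        (𝓝 0) := by
      refine Real.tendsto_exp_atBot.comp ?_
      have : Tendsto (fun X : ℝ => Real.log X ^ (3 / 5 - 1 / 10 : ℝ)) atTop atTop :=
        (tendsto_rpow_atTop (by norm_num)).comp Real.tendsto_log_atTop
      simpa using this.const_mul_atTop_of_neg (by norm_num : (-1 : ℝ) < 0)
    exact (h1.eventually (gt_mem_nhds hεpos)).mono fun _ h => h.le
  obtain ⟨η₁, hη₁⟩ := eventually_atTop.mp (hT1.and hT2)
  obtain ⟨X₁, hX₁⟩ := eventually_atTop.mp hT3
  -- a Siegel zero of quality `η ≥ η₁` at a conductor `q ≥ max q₁ ⌈X₁⌉ 2`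
  obtain ⟨q, inst, χ, η, hq, hη, hprim, hquad, hη10, hL⟩ := hU η₁ (max q₁ (max ⌈X₁⌉₊ 2))
  have hqq₁ : q₁ ≤ q := le_of_max_le_left hq
  have hqX₁ : ⌈X₁⌉₊ ≤ q := le_of_max_le_left (le_of_max_le_right hq)
  have hq2 : 2 ≤ q := le_of_max_le_right (le_of_max_le_right hq)
  have hqpos : 0 < q := by omega
  -- the thin bound at `q`
  have hT := hq₁ q hqq₁
  rw [primePairLambdaCount_thin_eq] at hT
  set N : ℕ := q ^ V with hN
  have hNpos : 0 < N := pow_pos hqpos V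
  have hNr : (0 : ℝ) < N := by exact_mod_cast hNpos
  have hqN : q ≤ N := by
    calc q = q ^ 1 := (pow_one q).symm
      _ ≤ q ^ V := Nat.pow_le_pow_right hqpos (by omega)
  have h2qN : 2 * q ≤ N := by
    calc 2 * q ≤ q * q := Nat.mul_le_mul_right q hq2
      _ = q ^ 2 := (sq q).symm
      _ ≤ q ^ V := Nat.pow_le_pow_right hqpos (by omega)
  have hcastq : (q : ℝ) ^ V = (N : ℝ) := by rw [hN, Nat.cast_pow]
  rw [hcastq] at hT
  set X : ℝ := (q : ℝ) ^ ((V : ℕ) : ℝ) with hXdef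
  have hXN : X = (N : ℝ) := by
    rw [hXdef, hN, Real.rpow_natCast, Nat.cast_pow]
  -- Matomäki–Merikoski at `h = 2q`, exponent `V`, `X = q^V`
  have hA : ((2 * q : ℕ) : ℝ) ≤ 1 * X := by
    rw [hXN, one_mul]; exact_mod_cast h2qN
  have hM := hMM' q hq2 χ hprim hquad η hη10 hL (V : ℝ) X hVr hXdef (2 * q) (by omega) hA
  rw [SiegelZeroPrimePairBarrierNarrow.correction_two_mul hqpos, hXN, Nat.floor_natCast] at hM
  -- bookkeeping
  set S : ℝ := ∑ n ∈ Icc 1 N, Λ n * Λ (n + 2 * q) with hS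
  set 𝔖 : ℝ := goldbachSingularSeries (2 * q) with h𝔖
  set ρ : ℝ := ((2 * q : ℕ) : ℝ) / (Nat.totient (2 * q) : ℝ) with hρ
  have hρ1 : 1 ≤ ρ := by
    have hφpos : (0 : ℝ) < (Nat.totient (2 * q) : ℝ) := by
      exact_mod_cast Nat.totient_pos.mpr (by omega)
    rw [hρ, le_div_iff₀ hφpos, one_mul]
    exact_mod_cast Nat.totient_le (2 * q)
  have hρ0 : 0 ≤ ρ := zero_le_one.trans hρ1
  have h𝔖ρ : twinPrimeConst * ρ ≤ 𝔖 :=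
    MontgomeryVaughan1975.twinPrimeConst_mul_div_totient_le (even_two_mul q) (by omega)
  obtain ⟨hE1, hE2⟩ := hη₁ η hη
  have hX₁N : X₁ ≤ (N : ℝ) :=
    (Nat.le_ceil X₁).trans (by exact_mod_cast hqX₁.trans hqN)
  have hE3 := hX₁ (N : ℝ) hX₁N
  -- `δ 𝔖 N ≤ 2N𝔖 − S + ((2−δ)𝔖N − ...)`: combine the two bounds
  have hKρN : 0 ≤ K * ρ * (N : ℝ) := mul_nonneg (mul_nonneg hK.le hρ0) hNr.le
  have hM' : |S - (N : ℝ) * 𝔖 * 2| ≤ K * ρ * N * (3 * ε) :=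
    hM.trans (mul_le_mul_of_nonneg_left (by linarith) hKρN)
  have key : δ * 𝔖 * N ≤ K * ρ * N * (3 * ε) := by
    have ha := neg_abs_le (S - (N : ℝ) * 𝔖 * 2)
    have h1 : (2 - δ) * 𝔖 * (N : ℝ) = (N : ℝ) * 𝔖 * 2 - δ * 𝔖 * N := by ring
    linarith
  have h3ε : K * ρ * (N : ℝ) * (3 * ε) = (N : ℝ) * (3 / 4 * (δ * twinPrimeConst) * ρ) := by
    rw [hε, show K * ρ * (N : ℝ) * (3 * (δ * twinPrimeConst / (4 * K))) =
      (N : ℝ) * (3 / 4 * (δ * twinPrimeConst) * ρ) * (K / K) by ring, div_self hK.ne', mul_one]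
  rw [h3ε] at key
  have hfin : δ * 𝔖 ≤ 3 / 4 * (δ * twinPrimeConst) * ρ := by
    have h' : (N : ℝ) * (δ * 𝔖) ≤ (N : ℝ) * (3 / 4 * (δ * twinPrimeConst) * ρ) := by linarith
    exact le_of_mul_le_mul_left h' hNr
  have hδ𝔖 : δ * (twinPrimeConst * ρ) ≤ δ * 𝔖 := mul_le_mul_of_nonneg_left h𝔖ρ hδ.le
  have hpos : 0 < δ * (twinPrimeConst * ρ) := by positivity
  nlinarith

/-! ### 4. The sharp record -/

/-- **The Siegel-zero obstruction to shift-uniform prime-pair upper bounds — sharp record**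
(barrier audit 2026-08-16, D-0021; CONFIRMS and SHARPENS `SiegelZeroPrimePairBarrier`, which it
implies: `siegelZeroPrimePairBarrier_of_narrow`). The `(2 − δ)`-upper bound of Goldston–Suriajaya's
hypothesis (10) (`HLPrimePairUpperBoundConj`) is needed only on the THIN family
`(x, k) = (q^V + 2q, 2q)`, `q` large, `V ≥ 10` fixed (`HLPrimePairUpperBoundThin V δ`; an
instance of `HLPrimePairUpperBoundConj δ'` for every `δ' > δ`), and it yields the no-Siegel-zero statement
`Literature.NumberTheory.LFunctions.NoSiegelZeros` itself (rh.S34: some `c > 0` with `L(σ, χ) ≠ 0` for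
`σ > 1 − c/log q`, every `q ≥ 3`, every real primitive `χ`) — the prime-pair twin of "if a weak
form of [the Goldbach asymptotic] holds, then there cannot be Siegel zeros" (Corollary 1.2, one
`h ≡ 0 (mod q)`; "we only need … the upper bound in (1.6) if `χ(−1) = 1`")
[cite: MatomakiMerikoski2023, Corollary 1.2 and Theorem 1.3] and of Friedlander–Iwaniec's
improvement of Goldston–Suriajaya's `C(δ)/log² q` to `c(δ)/log q` ("there are no zeros of any
Dirichlet `L`-function in the region (1.1) with a positive constant `c` which is now allowed to
depend on `δ`") [cite: FriedlanderIwaniec2021, Theorem 1] [cite: FriedlanderIwaniec2022, §4 (Theorem)].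
PROVED modulo the vendored Theorem 1.3 (`SiegelZeroPrimePairBarrierNarrow_of_pairCorrelation`).

BARRIER (D-0021; one line per key):
technique_class: exceptional-character-blind siegel-zero-consistent shift-uniform-bounds uniform-hardy-littlewood uniform-bateman-horn weak-goldbach goldbach-in-progressions — as catalogued; sharpened: any argument delivering, for every large modulus `q`, the one-sided bound `ψ₂(x, k) ≤ (2 − δ)𝔖(k)(x − k)` at ONE shift `k ≡ 0 (mod q)`, `k = O(x)`, and ONE height `x − k = q^V`, `V ≥ 10` (here `k = 2q`, `V = 10`) — in particular every proof of `HLPrimePairUpperBoundConj δ`, of a version uniform in `k ≤ x^θ` (`θ > 0`), or of a version uniform in `x ≥ k^C` [cite: GoldstonSuriajaya2021, §1 (10) and Theorem 2] [cite: MatomakiMerikoski2023, Theorem 1.3].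
blocks: the SHIFT-UNIFORM strengthening of the prime-pair case `(X, X + k)` of Bateman–Horn / Hardy–Littlewood tuples (sub-problem `BatemanHorn`; the tree's `Literature.NumberTheory.Sieve.HardyLittlewoodTuples`), in the sharp two-sided form: (i) HARDNESS — such an argument is a proof of rh.S34 `NoSiegelZeros` (the tree's no-Siegel-zero statement, not known; reached as `¬UnboundedSiegelZeros`, bounded quality `η < η₀(δ)` at conductors `q ≥ q₀`, then `noSiegelZeros_of_not_unboundedSiegelZeros`), strictly more than the catalogued repulsion `β₁ < 1 − C(δ)/log² q` [cite: GoldstonSuriajaya2021, Theorems 2, 3] and on a par with the Goldbach side [cite: FriedlanderIwaniec2021, Theorem 1 and §7 (Conclusion)] [cite: MatomakiMerikoski2023, Corollary 1.2]; (ii) ILLUSORY FALSITY — with Siegel zeros of unbounded quality at arbitrarily large conductors (`UnboundedSiegelZeros`, consistent with every theorem of the tree) the thin family itself fails: `ψ₂(q^V + 2q, 2q) = (2 + o(1))𝔖(2q)q^V` along the exceptional conductors ("one would expect that `∑_{n ≤ X} Λ(n)Λ(n+q) ≈ 2𝔖_q X`. The following general theorem confirms this intuition") [cite: MatomakiMerikoski2023,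 §1 (before Theorem 1.3) and Theorem 1.3] — so no argument all of whose steps survive such zeros proves even the thin family.
because: at a real zero `β₀ = 1 − 1/(η log q)` of a primitive quadratic `χ` mod `q = 2^r q'`, Theorem 1.3 (`C = 1`, `ε = 1/10`, `A = 1`, `X = q^V`, `V ≥ 10`, `h = 2q`) reads `|∑_{n ≤ q^V} Λ(n)Λ(n + 2q) − (1 + 𝔠)𝔖(2q)q^V| ≤ K (2q/φ(2q)) q^V (e^{−√(V log η)} + e^{−√(V log q)} + V log⁶η/η)` with correction `𝔠 = 1_{φ(2^r) ∣ 2q}(−1)^{2q/φ(2^r)}∏_{p ∣ q', p ∤ 2q}(−1)/(p − 2) = +1` (`φ(2^r) ∣ q`, `2q/φ(2^r)` even, empty product: `SiegelZeroPrimePairBarrierNarrow.correction_two_mul`) — the primes crowd into the classes `χ = −1`, which `n ↦ n + 2q` preserves; the thin bound caps the same sum (`primePairLambdaCount_thin_eq`) at `(2 − δ)𝔖(2q)q^V`, and `𝔖(2q) ≥ C₂ · 2q/φ(2q)` (`Literature.NumberTheory.Sieve.MontgomeryVaughan1975.twinPrimeConst_mul_div_totient_le`), whence `δC₂ ≤ 3Kε`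 as soon as the three error factors are `≤ ε` — false for `ε = δC₂/(4K)`, which large `η` and `q` would grant [cite: MatomakiMerikoski2023, Theorem 1.3]; Goldston–Suriajaya's own route stops at `log² q` only because the prime number theorem for progressions with error `O(x e^{−c₁√log x})` forces the height `log N = (log q/c'')²` [cite: GoldstonSuriajaya2021, §5 (proof of Theorem 3)], a limitation Friedlander–Iwaniec remove with Bombieri's log-free density theorem at `N ≥ q^{b+1}` [cite: FriedlanderIwaniec2021, §4 (Proposition 4.1) and §5].
evasions_known: none in print for the thin family or anything containing it; NOT obstructed by this entry (the complement — information, not licence; Selberg's parity barrier still stands there): (a) FIXED shifts / fixed Bateman–Horn systems — an exceptional zero even proves the pair asymptotic on `X ∈ [q^{10}, q^{η^{1−ε}}]` [cite: MatomakiMerikoski2023, Corollary 1.1]; (b) shifts in the Siegel–Walfisz range `k ≤ (log x)^A` — every `q ∣ k` is `≤ (log x)^A`, where an exceptional zero is invisible at height `x` (`errorFactor_ge_one_of_le_log_pow`: the error factor `V log⁶η/η` of Theorem 1.3 is `≥ 1` by Siegel's theorem `η ≪_ε q^ε`; Goldston–Suriajaya need `q = e^{c''√log N}`) [cite: MatomakiMerikoski2023,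 the deduction after Theorem 1.4] [cite: MontgomeryVaughan2007, Corollary 11.15]; (c) shift families avoiding the multiples of large conductors (e.g. `B`-smooth shifts, `B ≥ 3`): all but finitely many exceptional conductors `q = 2^r q'` have a prime `P > B` of the squarefree `q'` with `P ∤ k`, and the correction factor `1 + θ∏_{p ∣ q', p ∤ k}(p − 2)^{−1}`, `θ ∈ {0, ±1}`, then lies in `1 ± 1/(B − 1)`, so for `δ < 1 − 1/(B − 1)` the illusory world itself obeys the `(2 − δ)` bound there [cite: MatomakiMerikoski2023, Theorem 1.3 and the remark after it]; (d) qualitative existence (Goldbach, twin primes without constants): "one should not lose hope of proving the original Goldbach [statement] before killing off the exceptional characters … one can skip counting many inconvenient representations" [cite: FriedlanderIwaniec2022, §5 (Remarks)]. Conversely an exceptional SET does not evade: weak Goldbach bounds off a power-sized exceptional set of `N ≡ 0 (mod r̃)` at `X = r̃^A`, `A > 5/2`, still exclude `β̃ > 1 − c/log X` [cite: BhowmikGrimmelt2026, Theorem 8.2].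
scope_caveats: (a) PROVED here only MODULO the vendored `MatomakiMerikoski2023_pairCorrelation` (Theorem 1.3; large parts of its proof are in the tree, `SiegelZeroPrimePairs*.lean`, but no `_holds` yet) — unconditionally the tree has the catalogued `log² q` record (`SiegelZeroPrimePairBarrier_holds`) and, on the Goldbach side in print, the `c(δ)/log q` theorem of Friedlander–Iwaniec / FGIS [cite: FriedlanderIwaniec2022, §4]; (b) constants: `η₀(δ) `and `q₀` come from the unspecified `K = K(1, 1/10, 1)` of Theorem 1.3 and are not made explicit; the `c` of `NoSiegelZeros` obtained through `noSiegelZeros_of_not_unboundedSiegelZeros` is ineffective in the small conductors (continuity at `s = 1`), as is every constant downstream of Siegel's theorem [cite: MatomakiMerikoski2023, the deduction after Theorem 1.4]; (c) the exponents `V ≥ 10` and the shift `2q` are conveniences of Theorem 1.3 (`V ≥ 10`, `h = O(X)`; any `k = 2qj ≤ X` doubles the main term as well); Bhowmik–Grimmelt work at `X = r̃^A`, `A > 5/2`, on the Goldbach side [cite: BhowmikGrimmelt2026, §8]; (d) `Λ`-weighted counts, positive shifts; (e) LOWER bounds `ψ₂ ≥ δ𝔖(k)(x − k)` are not recorded here: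 in the illusory world a lower bound with `δ < 2/3` fails only at `χ`-reversing shifts (correction factor `0`), available only when `3 ∣ q` or `4 ∣ q` ("the main term vanishes for some even `h`, for instance when `3 ∣ q` and `h = 2q/3`") [cite: MatomakiMerikoski2023, remark after Theorem 1.3]; (f) non-linear Bateman–Horn systems are not addressed by the cited sources.
status: established — PROVED modulo `MatomakiMerikoski2023_pairCorrelation` (`SiegelZeroPrimePairBarrierNarrow_of_pairCorrelation`); implies the catalogued record (`siegelZeroPrimePairBarrier_of_narrow`) [cite: MatomakiMerikoski2023, Theorem 1.3 and Corollary 1.2] [cite: FriedlanderIwaniec2021, Theorem 1] -/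
def SiegelZeroPrimePairBarrierNarrow : Prop :=
  ∀ V : ℕ, 10 ≤ V → ∀ δ : ℝ, 0 < δ → HLPrimePairUpperBoundThin V δ → NoSiegelZeros

/-- **The sharp record, PROVED modulo Matomäki–Merikoski's Theorem 1.3**
(`MatomakiMerikoski2023_pairCorrelation`): the thin family bounds the quality of Siegel zeros at
large conductors (`not_unboundedSiegelZeros_of_hlPrimePairUpperBoundThin`), and bounded quality at
large conductors is already rh.S34 (`noSiegelZeros_of_not_unboundedSiegelZeros`: the finitely many
small conductors are zero-free near `1` by continuity). [cite: MatomakiMerikoski2023, Theorem 1.3 and Corollary 1.2] -/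
theorem SiegelZeroPrimePairBarrierNarrow_of_pairCorrelation
    (hMM : MatomakiMerikoski2023_pairCorrelation) : SiegelZeroPrimePairBarrierNarrow :=
  fun _ hV _ hδ hThin =>
    noSiegelZeros_of_not_unboundedSiegelZeros
      (not_unboundedSiegelZeros_of_hlPrimePairUpperBoundThin hMM hV hδ hThin)

/-- **Goldston–Suriajaya's hypothesis gives rh.S34** (modulo Theorem 1.3): for every `0 < δ`,
`HLPrimePairUpperBoundConj δ → NoSiegelZeros` — compare the catalogued conclusion
`β₁ < 1 − C(δ)/log² q`. [cite: GoldstonSuriajaya2021, Theorem 2] [cite: MatomakiMerikoski2023, Theorem 1.3] -/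
theorem noSiegelZeros_of_hlPrimePairUpperBoundConj (hMM : MatomakiMerikoski2023_pairCorrelation)
    {δ : ℝ} (hδ : 0 < δ) (h : HLPrimePairUpperBoundConj δ) : NoSiegelZeros :=
  SiegelZeroPrimePairBarrierNarrow_of_pairCorrelation hMM 10 le_rfl (δ / 2) (by linarith)
    (hlPrimePairUpperBoundThin_of_conj (by norm_num) (by linarith) h)

/-- The quality form of the conclusion: under the thin bound (modulo Theorem 1.3) there are `η₀`,
`q₀` such that every Siegel zero (`IsSiegelZero χ η`: `χ` primitive quadratic mod `q`,
`L(1 − 1/(η log q), χ) = 0`, `η ≥ 10`) at a conductor `q ≥ q₀` has quality `η < η₀`.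
[cite: MatomakiMerikoski2023, Theorem 1.3] [cite: TaoTeravainen2021, Definition 1.4] -/
theorem siegelZeroQuality_lt_of_hlPrimePairUpperBoundThin
    (hMM : MatomakiMerikoski2023_pairCorrelation) {V : ℕ} (hV : 10 ≤ V) {δ : ℝ} (hδ : 0 < δ)
    (hThin : HLPrimePairUpperBoundThin V δ) :
    ∃ η₀ : ℝ, ∃ q₀ : ℕ, ∀ (q : ℕ) [NeZero q] (χ : DirichletCharacter ℂ q) (η : ℝ),
      q₀ ≤ q → IsSiegelZero χ η → η < η₀ :=
  not_unboundedSiegelZeros_iff.mp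
    (not_unboundedSiegelZeros_of_hlPrimePairUpperBoundThin hMM hV hδ hThin)

/-! ### 5. The sharp record implies the catalogued one -/

namespace SiegelZeroPrimePairBarrierNarrow

/-- A non-trivial Dirichlet character lives at a level `≥ 3` (every character mod `1` or mod `2`
is trivial). [folklore] -/
theorem three_le_level_of_ne_one {d : ℕ} [NeZero d] (ψ : DirichletCharacter ℂ d) (hψ : ψ ≠ 1) :
    3 ≤ d := by
  by_contra hlt
  rw [not_le] at hlt
  have h1 : 1 ≤ d := Nat.pos_of_ne_zero (NeZero.ne d)
  interval_cases d
  · exact hψ (DirichletCharacter.level_one ψ)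
  · have hsub : Subsingleton (ZMod 2)ˣ := by
      refine Fintype.card_le_one_iff_subsingleton.mp ?_
      rw [ZMod.card_units_eq_totient, Nat.totient_two]
    exact hψ (MulChar.ext fun a => by rw [Subsingleton.elim a 1, Units.val_one, map_one, map_one])

/-- The Euler factors removed when inducing a character are non-zero on the positive real axis:
`1 − ψ(p)p^{−β} ≠ 0` for `p ≥ 2`, `β > 0` (`|ψ(p)p^{−β}| ≤ p^{−β} < 1`). [folklore] -/
theorem one_sub_mul_cpow_ne_zero {d : ℕ} [NeZero d] (ψ : DirichletCharacter ℂ d) {p : ℕ}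
    (hp : 2 ≤ p) {β : ℝ} (hβ : 0 < β) :
    1 - ψ (p : ZMod d) * (p : ℂ) ^ (-(β : ℂ)) ≠ 0 := by
  have hlt : (p : ℝ) ^ (-β) < 1 :=
    Real.rpow_lt_one_of_one_lt_of_neg (by exact_mod_cast hp) (by linarith)
  have h0 : 0 ≤ (p : ℝ) ^ (-β) := by positivity
  have hcast : (p : ℂ) ^ (-(β : ℂ)) = (((p : ℝ) ^ (-β) : ℝ) : ℂ) := by
    rw [Complex.ofReal_cpow (Nat.cast_nonneg _), Complex.ofReal_neg, Complex.ofReal_natCast]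
  rw [hcast, sub_ne_zero]
  intro h
  have hnorm : ‖ψ (p : ZMod d) * (((p : ℝ) ^ (-β) : ℝ) : ℂ)‖ < 1 := by
    rw [norm_mul, Complex.norm_real, Real.norm_eq_abs, abs_of_nonneg h0]
    calc ‖ψ (p : ZMod d)‖ * (p : ℝ) ^ (-β) ≤ 1 * (p : ℝ) ^ (-β) :=
          mul_le_mul_of_nonneg_right (DirichletCharacter.norm_le_one ψ _) h0
      _ < 1 := by linarith
  rw [← h, norm_one] at hnorm
  exact lt_irrefl _ hnorm

/-- **rh.S34 clears the whole window of the catalogued record.** From `NoSiegelZeros` (real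
PRIMITIVE characters, `q ≥ 3`): there is `c > 0` such that for every `q ≥ 3`, every real
(`IsQuadratic`, the principal character included) `χ` mod `q` and every real `β` with
`1 − c/log q < β < 1`, `L(β, χ) ≠ 0`. For `χ = χ₀`: `L(β, χ₀) = ζ(β)∏_{p ∣ q}(1 − p^{−β}) ≠ 0` on
`(0, 1)` (`GoldstonSuriajaya.LFunction_one_ne_zero_of_pos_of_lt_one`; `c ≤ log 3` keeps `β > 0`); for
`χ ≠ χ₀` induced by the primitive `χ*` of conductor `d ∣ q`, `3 ≤ d ≤ q`:
`L(β, χ) = L(β, χ*)∏_{p ∣ q}(1 − χ*(p)p^{−β})` (Mathlib `LFunction_changeLevel`) with non-zero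
factors, and `1 − c/log d ≤ 1 − c/log q < β`. [folklore] -/
theorem windowZeroFree_of_noSiegelZeros (h : NoSiegelZeros) :
    ∃ c : ℝ, 0 < c ∧ ∀ (q : ℕ) [NeZero q], 3 ≤ q → ∀ χ : DirichletCharacter ℂ q, χ.IsQuadratic →
      ∀ β : ℝ, 1 - c / Real.log q < β → β < 1 → χ.LFunction (β : ℂ) ≠ 0 := by
  obtain ⟨c, hc, hzf⟩ := h
  have hlog3 : 0 < Real.log 3 := Real.log_pos (by norm_num)
  refine ⟨min c (Real.log 3), lt_min hc hlog3, fun q _ hq χ hquad β hβ hβ1 hL => ?_⟩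
  have hq3 : (3 : ℝ) ≤ q := by exact_mod_cast hq
  have hlogq : Real.log 3 ≤ Real.log q := Real.log_le_log (by norm_num) hq3
  have hlogq0 : 0 < Real.log q := by linarith
  have hβ0 : 0 < β := by
    have h1 : min c (Real.log 3) / Real.log q ≤ 1 := by
      rw [div_le_one hlogq0]; exact (min_le_right _ _).trans hlogq
    linarith
  by_cases hχ1 : χ = 1
  · subst hχ1
    exact GoldstonSuriajaya.LFunction_one_ne_zero_of_pos_of_lt_one q hβ0 hβ1 hL
  · haveI : NeZero χ.conductor := ⟨χ.conductor_ne_zero⟩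
    set ψ := χ.primitiveCharacter with hψdef
    have hχψ : DirichletCharacter.changeLevel χ.conductor_dvd_level ψ = χ :=
      DirichletCharacter.changeLevel_primitiveCharacter χ
    have hψ1 : ψ ≠ 1 := fun h' => hχ1 (by rw [← hχψ, h', map_one])
    have hsq : χ ^ 2 = 1 := MulChar.isQuadratic_iff_sq_eq_one.mp hquad
    have hψsq : ψ ^ 2 = 1 :=
      DirichletCharacter.changeLevel_injective χ.conductor_dvd_level
        (by rw [map_pow, hχψ, hsq, map_one])
    have hψquad : ψ.IsQuadratic := MulChar.isQuadratic_iff_sq_eq_one.mpr hψsq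
    have hψprim : ψ.IsPrimitive := DirichletCharacter.primitiveCharacter_isPrimitive χ
    have hd3 : 3 ≤ χ.conductor := three_le_level_of_ne_one ψ hψ1
    have hdq : χ.conductor ≤ q := Nat.le_of_dvd (by omega) χ.conductor_dvd_level
    have hLψ : ψ.LFunction β = 0 := by
      have hfac := DirichletCharacter.LFunction_changeLevel χ.conductor_dvd_level ψ
        (s := (β : ℂ)) (Or.inl hψ1)
      rw [hχψ] at hfac
      rw [hfac] at hL
      rcases mul_eq_zero.mp hL with h' | h'
      · exact h'
      · exact absurd h' (Finset.prod_ne_zero_iff.mpr fun p hp =>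
          one_sub_mul_cpow_ne_zero ψ (Nat.prime_of_mem_primeFactors hp).two_le hβ0)
    have hd3r : (3 : ℝ) ≤ χ.conductor := by exact_mod_cast hd3
    have hlogd3 : Real.log 3 ≤ Real.log χ.conductor := Real.log_le_log (by norm_num) hd3r
    have hlogd0 : 0 < Real.log χ.conductor := by linarith
    have hlogdq : Real.log χ.conductor ≤ Real.log q :=
      Real.log_le_log (by linarith) (by exact_mod_cast hdq)
    have hwin : 1 - c / Real.log χ.conductor < β := by
      have h1 : min c (Real.log 3) / Real.log q ≤ c / Real.log χ.conductor :=
        calc min c (Real.log 3) / Real.log q ≤ c / Real.log q :=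
              div_le_div_of_nonneg_right (min_le_left _ _) hlogq0.le
          _ ≤ c / Real.log χ.conductor := div_le_div_of_nonneg_left hc.le hlogd0 hlogdq
      linarith
    exact hzf χ.conductor hd3 ψ hψquad hψprim β hwin hLψ

end SiegelZeroPrimePairBarrierNarrow

/-- **rh.S34 implies the catalogued record outright** (its conclusion holds with an EMPTY window of
exceptional zeros, whatever the hypothesis): `NoSiegelZeros → SiegelZeroPrimePairBarrier`. [folklore] -/
theorem siegelZeroPrimePairBarrier_of_noSiegelZeros (h : NoSiegelZeros) : SiegelZeroPrimePairBarrier := by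
  obtain ⟨c, hc, hzf⟩ := SiegelZeroPrimePairBarrierNarrow.windowZeroFree_of_noSiegelZeros h
  refine ⟨c, hc, fun δ _ _ _ => ⟨1, one_pos, 3, fun q _ hq χ hquad β hβ hβ1 hL => ?_⟩⟩
  exact absurd hL (hzf q hq χ hquad β hβ hβ1)

/-- **The sharp record implies the catalogued one** (`SiegelZeroPrimePairBarrierNarrow →
SiegelZeroPrimePairBarrier`): if some `HLPrimePairUpperBoundThin 10 δ`, `δ > 0`, holds then rh.S34
holds and the catalogued conclusion follows for every `C` (`siegelZeroPrimePairBarrier_of_noSiegelZeros`);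
otherwise no `HLPrimePairUpperBoundConj δ`, `0 < δ < 1`, holds (`hlPrimePairUpperBoundThin_of_conj`)
and the catalogued record is vacuous. [folklore] -/
theorem siegelZeroPrimePairBarrier_of_narrow (hN : SiegelZeroPrimePairBarrierNarrow) :
    SiegelZeroPrimePairBarrier := by
  by_cases hex : ∃ δ : ℝ, 0 < δ ∧ HLPrimePairUpperBoundThin 10 δ
  · obtain ⟨δ, hδ, hT⟩ := hex
    exact siegelZeroPrimePairBarrier_of_noSiegelZeros (hN 10 le_rfl δ hδ hT)
  · refine ⟨1, one_pos, fun δ hδ _ hH => ?_⟩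
    exact absurd ⟨δ / 2, by linarith,
      hlPrimePairUpperBoundThin_of_conj (by norm_num) (by linarith) hH⟩ hex

/-! ### 6. Where the obstruction is silent: conductors in the Siegel–Walfisz range -/

/-- **Theorem 1.3 is void at conductors `q ≤ (log X)^A`.** For every `A > 0` there is `X₀` such
that for `X ≥ X₀`, every modulus `q ≤ (log X)^A` and every Siegel zero of quality `η` attached to
a primitive quadratic character mod `q`, the last error factor of Matomäki–Merikoski's Theorem 1.3
at the height `X = q^V` is at least `1`: `V log⁶η/η ≥ 1`, `V = log X/log q` — the "asymptotic"
then carries no information. By Siegel's theorem (tree: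
`Literature.NumberTheory.LFunctions.Siegel.exists_one_sub_realZero_ge`, `ε = 1/(2A)`):
`η ≤ q^{1/(2A)}/(C log q) ≤ (log X)^{1/2}/C`, while `V ≥ log X/(A log log X)`. This is the
formal shadow of the Siegel–Walfisz theorem: at height `x` an exceptional zero of conductor
`q ≤ (log x)^A` is invisible (`x^{β₀−1} = e^{−V/η} → 0`), so for shift families with
`k ≤ (log x)^A` (hence `q ≤ k ≤ (log x)^A` for every `q ∣ k`) the illusory world predicts the plain
Hardy–Littlewood asymptotic and the present obstruction does not apply ("by Siegel's theorem
`η ≪_ε q^ε`"). [cite: MatomakiMerikoski2023, Theorem 1.3 and the deduction after Theorem 1.4] [cite: MontgomeryVaughan2007, Corollary 11.15] -/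
theorem errorFactor_ge_one_of_le_log_pow {A : ℝ} (hA : 0 < A) :
    ∃ X₀ : ℝ, ∀ X : ℝ, X₀ ≤ X → ∀ (q : ℕ) [NeZero q] (χ : DirichletCharacter ℂ q) (η : ℝ),
      (q : ℝ) ≤ Real.log X ^ A → IsSiegelZero χ η →
        1 ≤ Real.log X / Real.log q * Real.log η ^ (6 : ℕ) / η := by
  obtain ⟨C, hC, hS⟩ := Siegel.exists_one_sub_realZero_ge (ε := 1 / (2 * A)) (by positivity)
  -- eventually `A log log X ≤ C (log X)^{1/2}` and `log X ≥ 1`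
  have hev : ∀ᶠ X : ℝ in atTop,
      A * Real.log (Real.log X) ≤ C * Real.log X ^ (1 / 2 : ℝ) ∧ 1 ≤ Real.log X := by
    have h1 : ∀ᶠ Y : ℝ in atTop, A * Real.log Y ≤ C * Y ^ (1 / 2 : ℝ) := by
      have hlo := (isLittleO_log_rpow_atTop (by norm_num : (0 : ℝ) < 1 / 2)).bound
        (by positivity : (0 : ℝ) < C / A)
      filter_upwards [hlo, eventually_ge_atTop (1 : ℝ)] with Y hY hY1
      rw [Real.norm_eq_abs, Real.norm_eq_abs, abs_of_nonneg (Real.log_nonneg hY1),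
        abs_of_nonneg (by positivity)] at hY
      calc A * Real.log Y ≤ A * (C / A * Y ^ (1 / 2 : ℝ)) := mul_le_mul_of_nonneg_left hY hA.le
        _ = C * Y ^ (1 / 2 : ℝ) := by field_simp
    filter_upwards [Real.tendsto_log_atTop.eventually h1,
      Real.tendsto_log_atTop.eventually (eventually_ge_atTop (1 : ℝ))] with X hX hX1
    exact ⟨hX, hX1⟩
  obtain ⟨X₀, hX₀⟩ := eventually_atTop.mp hev
  refine ⟨X₀, fun X hX q _ χ η hq hZ => ?_⟩
  obtain ⟨hlogle, hlog1⟩ := hX₀ X hX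
  have hq3 : 3 ≤ q := hZ.three_le
  obtain ⟨hprim, hquad, hη10, hL⟩ := hZ
  have hq3r : (3 : ℝ) ≤ q := by exact_mod_cast hq3
  have hq0 : (0 : ℝ) < q := by linarith
  have he3 : Real.exp 1 ≤ 3 := Real.exp_one_lt_d9.le.trans (by norm_num)
  have hlogq : 1 ≤ Real.log q := by
    rw [← Real.log_exp 1]
    exact Real.log_le_log (Real.exp_pos 1) (he3.trans hq3r)
  have hlogη : 1 ≤ Real.log η := by
    rw [← Real.log_exp 1]
    exact Real.log_le_log (Real.exp_pos 1) (by linarith)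
  have hη0 : 0 < η := by linarith
  have hlogX0 : 0 < Real.log X := by linarith
  -- `χ ≠ χ₀`, `χ² = χ₀`
  have hχ1 : χ ≠ 1 := by
    intro h1
    rw [DirichletCharacter.isPrimitive_def, h1, DirichletCharacter.conductor_one] at hprim
    omega
  have hsq : χ ^ 2 = 1 := MulChar.isQuadratic_iff_sq_eq_one.mp hquad
  -- Siegel: `C q^{-ε} ≤ 1 − β₀ = 1/(η log q)`, so `η ≤ q^ε/C`
  have hSiegel := hS q χ hsq hχ1 (1 - 1 / (η * Real.log q)) hL
  have hηle : η ≤ (q : ℝ) ^ (1 / (2 * A)) / C := by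
    have h1 : C * (q : ℝ) ^ (-(1 / (2 * A))) ≤ 1 / (η * Real.log q) := by linarith
    have h2 : 1 / (η * Real.log q) ≤ 1 / η :=
      one_div_le_one_div_of_le hη0 (le_mul_of_one_le_right hη0.le hlogq)
    have h3 := h1.trans h2
    have hpow : 0 < (q : ℝ) ^ (-(1 / (2 * A))) := Real.rpow_pos_of_pos hq0 _
    have h4 : η ≤ 1 / (C * (q : ℝ) ^ (-(1 / (2 * A)))) := by
      rw [le_div_iff₀ (mul_pos hC hpow)]
      calc η * (C * (q : ℝ) ^ (-(1 / (2 * A)))) ≤ η * (1 / η) :=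
            mul_le_mul_of_nonneg_left h3 hη0.le
        _ = 1 := mul_one_div_cancel hη0.ne'
    calc η ≤ 1 / (C * (q : ℝ) ^ (-(1 / (2 * A)))) := h4
      _ = (q : ℝ) ^ (1 / (2 * A)) / C := by
          have hpow' : (q : ℝ) ^ (1 / (2 * A)) ≠ 0 := (Real.rpow_pos_of_pos hq0 _).ne'
          rw [Real.rpow_neg hq0.le]
          field_simp
  -- `q^{1/(2A)} ≤ (log X)^{1/2}` and `log q ≤ A log log X`
  have hqpow_le : (q : ℝ) ^ (1 / (2 * A)) ≤ Real.log X ^ (1 / 2 : ℝ) := by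
    calc (q : ℝ) ^ (1 / (2 * A)) ≤ (Real.log X ^ A) ^ (1 / (2 * A)) :=
          Real.rpow_le_rpow hq0.le hq (by positivity)
      _ = Real.log X ^ (1 / 2 : ℝ) := by
          rw [← Real.rpow_mul hlogX0.le, show A * (1 / (2 * A)) = 1 / 2 by field_simp]
  have hlogq_le : Real.log q ≤ A * Real.log (Real.log X) := by
    calc Real.log q ≤ Real.log (Real.log X ^ A) := Real.log_le_log hq0 hq
      _ = A * Real.log (Real.log X) := Real.log_rpow hlogX0 A
  have hAll : 0 < A * Real.log (Real.log X) := lt_of_lt_of_le (by linarith) hlogq_le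
  -- `η ≤ (log X)^{1/2}/C ≤ log X/(A log log X) ≤ V`
  have hηV : η ≤ Real.log X / Real.log q := by
    have step1 : η ≤ Real.log X ^ (1 / 2 : ℝ) / C :=
      hηle.trans (div_le_div_of_nonneg_right hqpow_le hC.le)
    have step2 : Real.log X ^ (1 / 2 : ℝ) / C ≤ Real.log X / (A * Real.log (Real.log X)) := by
      rw [div_le_div_iff₀ hC hAll]
      have hsqr : Real.log X ^ (1 / 2 : ℝ) * Real.log X ^ (1 / 2 : ℝ) = Real.log X := by
        rw [← Real.rpow_add hlogX0]; norm_num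
      calc Real.log X ^ (1 / 2 : ℝ) * (A * Real.log (Real.log X))
          ≤ Real.log X ^ (1 / 2 : ℝ) * (C * Real.log X ^ (1 / 2 : ℝ)) :=
            mul_le_mul_of_nonneg_left hlogle (by positivity)
        _ = C * (Real.log X ^ (1 / 2 : ℝ) * Real.log X ^ (1 / 2 : ℝ)) := by ring
        _ = Real.log X * C := by rw [hsqr, mul_comm]
    have step3 : Real.log X / (A * Real.log (Real.log X)) ≤ Real.log X / Real.log q :=
      div_le_div_of_nonneg_left hlogX0.le (by linarith) hlogq_le
    exact step1.trans (step2.trans step3)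
  have hVpos : 0 < Real.log X / Real.log q := div_pos hlogX0 (by linarith)
  have hlogη6 : 1 ≤ Real.log η ^ (6 : ℕ) := one_le_pow₀ hlogη
  calc (1 : ℝ) ≤ Real.log X / Real.log q / η := by
        rw [le_div_iff₀ hη0, one_mul]; exact hηV
    _ ≤ Real.log X / Real.log q * Real.log η ^ (6 : ℕ) / η := by
        apply div_le_div_of_nonneg_right _ hη0.le
        calc Real.log X / Real.log q = Real.log X / Real.log q * 1 := (mul_one _).symm
          _ ≤ Real.log X / Real.log q * Real.log η ^ (6 : ℕ) :=
              mul_le_mul_of_nonneg_left hlogη6 hVpos.le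

end Literature.Barriers.Parity
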